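import Summits.Ventures.HSemireg.HomFunctorPushforwardIso
import Literature.AlgebraicGeometry.HodgeTheory.HomComplexPullback
import HarnessLib

/-!
# Road №4 (`VHCAbelianSchemesRoad`), crux stmt-HodgeConjecture-26512 `DiagLocalOfMarkmanPinnedForall` — support line «sigma-descent-along-q»,
# library item (L2) `SigmaPullbackCompat`, step (Q1): **`𝓗om•(K, –) ⋙ f^*• ⟶ f^*• ⋙ 𝓗om•(f^*• K, –)` AS A SHIFT-COMPATIBLE NATURAL
# TRANSFORMATION** on the venture's `homFunctor` — the pull-back twin of `Summits/Ventures/HSemireg/HomFunctorPushforwardIso` (piece (N1) there)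

research route conditional on HC_CM; not a corollary; Q11.4-sentence-2 already refuted in dim ≥ 3.

Seat core-w5 gen 5 (width copy «width 5» of core-D; claim-free, `--supports stmt-HodgeConjecture-26512 --as helper`; director-hodge g17
R17.118 (1): «the ONE natural next piece is (L2)'s step (Q1)»). HONEST FRAMING: kernel bookkeeping on the venture's real carrier
`HomComplex.homFunctor Y K = 𝓗om•(K, –)` (`HomComplexSigma.lean`); nothing about any variety; proves NOTHING about (L2), (U-Σ), (N-U), any
registered stub, 26512, №4, HC_AV, HC_CM or HC; HC_CM HELD, by name only; typed ≠ proved. Declared in the cell's namespace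
`Summit.HodgeConjecture.HodgeConjecture.Ring2.SemiregularRepresentatives` (as the other Theorems-lane venture plumbing of this road), with the
venture's names opened.

For ANY morphism of schemes `f : X ⟶ Y` (`f^* = Scheme.Modules.pullback f`, `f^*•` termwise on cochain complexes) and a cochain complex
`K` of `𝒪_Y`-modules:

* §1 `homFunctorPullbackHomApp f K L : f^*• 𝓗om•(K, L) ⟶ 𝓗om•(f^*• K, f^*• L)` — the tree's object-level comparison
  `Literature.AlgebraicGeometry.HodgeTheory.homComplexPullbackHom` (module level: `Modules/SheafHomPullback.sheafHomPullbackComparison`,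
  Görtz–Wedhorn I (7.8.3)) RETYPED onto the venture's `homFunctor` (the venture and Literature copies of `homComplex` agree definitionally),
  its summand formula, and its NATURALITY in `L` (`homFunctorPullbackHomApp_naturality`);
* §2 **`homFunctorPullbackHom f K : homFunctor Y K ⋙ f^*• ⟶ f^*• ⋙ homFunctor X (f^*• K)`** and
  **`NatTrans.CommShift (homFunctorPullbackHom f K) ℤ`** (`homFunctorPullbackHom_commShift`) for Mathlib's shift structures
  (`BifunctorShift` first-variable shift on `𝓗om•(K, –)`, `Functor.commShiftMapCochainComplex` on `f^*•`; all identities summand by summand)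
  — the `τ` that `DerivedDescentBaseChange`-style transport consumes to move the middle factor `Φ_K = shiftedHomMap (𝓗om•(K, –))` of the
  venture's `σ_q` across `D(f^*)` for an EXACT `f^*` (flat `f`, e.g. the quotient isogeny `q` of the support line). A natural
  TRANSFORMATION in this direction suffices for that transport (Mathlib `Localization.liftNatTrans`); it is an isomorphism for `K` termwise
  finite locally free ON PAPER (Görtz–Wedhorn I Ex. 7.20 (a)) — NOT proved here.

References: The Stacks project, *More on Algebra*, Section «Hom complexes» [StacksProject]; U. Görtz, T. Wedhorn, *Algebraic Geometry I*,
2nd ed. (2020), (7.8.3), Exercise 7.20 (a) [GortzWedhorn2020]; C. A. Weibel (1994), §1.2 (1.2.6), 2.7.4–2.7.5, §10.4 [Weibel1994];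
R.-O. Buchweitz, H. Flenner (2003), §3 (functoriality of the Atiyah class and the trace under base change) [BuchweitzFlenner2003].
Bookkeeping along a pull-back (reading; no printed statement is typed verbatim).
-/

noncomputable section

-- `TopCat.Presheaf`/`Scheme.Modules`/`GradedObject` are not reducible.
set_option backward.isDefEq.respectTransparency false

open CategoryTheory CategoryTheory.Category CategoryTheory.Limits AlgebraicGeometry Opposite

universe u

namespace Summit.HodgeConjecture.HodgeConjecture.Ring2.SemiregularRepresentatives

set_option linter.dupNamespace false -- the cell's namespace repeats the summit name, as in every `Ring2*` file

open Literature.AlgebraicGeometry.Modules Literature.Algebra.Homology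
open Summit.Ventures.HSemireg Summit.Ventures.HSemireg.HomComplex

variable {X Y : Scheme.{u}} (f : X ⟶ Y) (K : CochainComplex Y.Modules ℤ)

/-! ## §1 The components and their naturality in `L` -/

/-- **`f^*• 𝓗om•(K, L) ⟶ 𝓗om•(f^*• K, f^*• L)`** typed on the venture's `homFunctor` (the tree's
`Literature.AlgebraicGeometry.HodgeTheory.homComplexPullbackHom`; the two copies of `homComplex` agree definitionally).
[cite: StacksProject, More on Algebra, Section «Hom complexes»] [cite: GortzWedhorn2020, (7.8.3) and Exercise 7.20 (a)] -/
def homFunctorPullbackHomApp (L : CochainComplex Y.Modules ℤ) :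
    (homFunctor Y K ⋙ (Scheme.Modules.pullback f).mapHomologicalComplex (ComplexShape.up ℤ)).obj L ⟶
      ((Scheme.Modules.pullback f).mapHomologicalComplex (ComplexShape.up ℤ) ⋙
        homFunctor X (((Scheme.Modules.pullback f).mapHomologicalComplex (ComplexShape.up ℤ)).obj K)).obj L :=
  Literature.AlgebraicGeometry.HodgeTheory.homComplexPullbackHom f K L

/-- **On summands**: `f^*(ι_{q,i}) ≫ (τ_L)_n = (f^* 𝓗om(K^{-i}, L^q) ⟶ 𝓗om(f^*K^{-i}, f^*L^q)) ≫ ι'_{q,i}`.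
[cite: StacksProject, More on Algebra, Section «Hom complexes»] -/
theorem map_ι_comp_homFunctorPullbackHomApp_f (L : CochainComplex Y.Modules ℤ) (q i n : ℤ) (h : q + i = n) :
    (Scheme.Modules.pullback f).map (ι Y K L q i n h) ≫ (homFunctorPullbackHomApp f K L).f n =
      sheafHomPullbackComparison f (K.X (-i)) (L.X q) ≫
        ι X (((Scheme.Modules.pullback f).mapHomologicalComplex (ComplexShape.up ℤ)).obj K)
          (((Scheme.Modules.pullback f).mapHomologicalComplex (ComplexShape.up ℤ)).obj L) q i n h :=
  Literature.AlgebraicGeometry.HodgeTheory.map_ι_comp_homComplexPullbackHom_f f K L q i n h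

/-- **A morphism out of `f^*(𝓗om•(K, L)^n)` is determined by its compositions with the `f^*(ι_{q,i})`** (`q + i = n`):
`f^*` (a left adjoint) preserves the coproduct `∐_{q+i=n} 𝓗om(K^{-i}, L^q)`. [cite: Weibel1994, §1.2, 1.2.6 and §2.6] -/
theorem pullback_ι_hom_ext {L : CochainComplex Y.Modules ℤ} {n : ℤ} {T : X.Modules}
    {a b : (Scheme.Modules.pullback f).obj ((homComplex Y K L).X n) ⟶ T}
    (h : ∀ (q i : ℤ) (hqi : q + i = n),
      (Scheme.Modules.pullback f).map (ι Y K L q i n hqi) ≫ a = (Scheme.Modules.pullback f).map (ι Y K L q i n hqi) ≫ b) :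
    a = b :=
  Literature.AlgebraicGeometry.HodgeTheory.pullback_ι_hom_ext f K L h

/-- **Naturality in `L`**: for a chain map `φ : L ⟶ L'`, `f^*•(𝓗om•(K, φ)) ≫ τ_{L'} = τ_L ≫ 𝓗om•(f^*•K, f^*•φ)` (summand by summand
the naturality of the module-level comparison in the second variable). [cite: StacksProject, More on Algebra, Section «Hom complexes»] -/
theorem homFunctorPullbackHomApp_naturality {L L' : CochainComplex Y.Modules ℤ} (φ : L ⟶ L') :
    ((Scheme.Modules.pullback f).mapHomologicalComplex (ComplexShape.up ℤ)).map ((homFunctor Y K).map φ) ≫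
        homFunctorPullbackHomApp f K L' =
      homFunctorPullbackHomApp f K L ≫
        (homFunctor X (((Scheme.Modules.pullback f).mapHomologicalComplex (ComplexShape.up ℤ)).obj K)).map
          (((Scheme.Modules.pullback f).mapHomologicalComplex (ComplexShape.up ℤ)).map φ) :=
  Literature.AlgebraicGeometry.HodgeTheory.homComplexPullbackHom_naturality f K φ

/-! ## §2 The natural transformation and its compatibility with shifts -/

/-- **`𝓗om•(K, –) ⋙ f^*• ⟶ f^*• ⋙ 𝓗om•(f^*• K, –)`** as a natural transformation of functors
`CochainComplex (Mod 𝒪_Y) ⥤ CochainComplex (Mod 𝒪_X)`. [cite: StacksProject, More on Algebra, Section «Hom complexes»]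
[cite: GortzWedhorn2020, (7.8.3) and Exercise 7.20 (a)] -/
def homFunctorPullbackHom :
    homFunctor Y K ⋙ (Scheme.Modules.pullback f).mapHomologicalComplex (ComplexShape.up ℤ) ⟶
      (Scheme.Modules.pullback f).mapHomologicalComplex (ComplexShape.up ℤ) ⋙
        homFunctor X (((Scheme.Modules.pullback f).mapHomologicalComplex (ComplexShape.up ℤ)).obj K) where
  app := homFunctorPullbackHomApp f K
  naturality _ _ φ := homFunctorPullbackHomApp_naturality f K φ

/-- Components of `homFunctorPullbackHom`. [cite: StacksProject, More on Algebra, Section «Hom complexes»] -/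
@[simp]
theorem homFunctorPullbackHom_app (L : CochainComplex Y.Modules ℤ) :
    (homFunctorPullbackHom f K).app L = homFunctorPullbackHomApp f K L := rfl

/-- The summand computation behind the shift compatibility, left-hand side: on the summand `(p, q)` of `𝓗om•(K, L⟦a⟧)^n`
(`p + q = n`; the summand object is `𝓗om(K^{-q}, L^{p+a})`), `f^*(ι) ≫ f^*((𝓗om•(K,–)-shift iso)_n) ≫ (f^*•-shift iso)_n ≫ (τ_L)_{n+a}`
is `(f^* 𝓗om(K^{-q}, L^{p+a}) ⟶ 𝓗om(f^*K^{-q}, f^*L^{p+a})) ≫ ι'_{p+a, q}`. [cite: Weibel1994, §1.2, 1.2.6 and §10.4] -/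
theorem pullback_shift_comm_summand_lhs (L : CochainComplex Y.Modules ℤ) (a p q n : ℤ) (hpq : p + q = n) :
    (Scheme.Modules.pullback f).map (ι Y K (L⟦a⟧) p q n hpq) ≫
        (Scheme.Modules.pullback f).map ((((homFunctor Y K).commShiftIso a).hom.app L).f n) ≫
          ((((Scheme.Modules.pullback f).mapHomologicalComplex (ComplexShape.up ℤ)).commShiftIso a).hom.app
              ((homFunctor Y K).obj L)).f n ≫
            ((shiftFunctor (HomologicalComplex X.Modules (ComplexShape.up ℤ)) a).map
                (homFunctorPullbackHomApp f K L)).f n =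
      sheafHomPullbackComparison f (K.X (-q)) (L.X (p + a)) ≫
        ι X (((Scheme.Modules.pullback f).mapHomologicalComplex (ComplexShape.up ℤ)).obj K)
          (((Scheme.Modules.pullback f).mapHomologicalComplex (ComplexShape.up ℤ)).obj L) (p + a) q (n + a) (by omega) := by
  rw [Functor.mapHomologicalComplex_commShiftIso_hom_app_f]
  erw [Category.id_comp, CochainComplex.shiftFunctor_map_f']
  rw [← Functor.map_comp_assoc]
  erw [Functor.commShiftIso_map₂CochainComplex_flip_hom_app]
  erw [CochainComplex.ι_mapBifunctorShift₁Iso_hom_f L (dualComplex Y K) (sheafHomBifunctor Y).flip a p q n hpq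
    (p + a) (n + a) rfl rfl]
  simp only [CochainComplex.shiftFunctorObjXIso, HomologicalComplex.XIsoOfEq, eqToIso_refl, Iso.refl_hom,
    Iso.refl_inv, Category.comp_id]
  exact map_ι_comp_homFunctorPullbackHomApp_f f K L (p + a) q (n + a) _

set_option maxHeartbeats 400000 in
/-- The summand computation, right-hand side: `f^*(ι) ≫ (τ_{L⟦a⟧})_n ≫ 𝓗om•(f^*•K, (f^*•-shift iso))_n ≫ ((𝓗om•(f^*•K,–)-shift iso)_{f^*•L})_n`
is the same morphism. [cite: Weibel1994, §1.2, 1.2.6 and §10.4] -/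
theorem pullback_shift_comm_summand_rhs (L : CochainComplex Y.Modules ℤ) (a p q n : ℤ) (hpq : p + q = n) :
    (Scheme.Modules.pullback f).map (ι Y K (L⟦a⟧) p q n hpq) ≫
        (homFunctorPullbackHomApp f K (L⟦a⟧)).f n ≫
          ((homFunctor X (((Scheme.Modules.pullback f).mapHomologicalComplex (ComplexShape.up ℤ)).obj K)).map
              ((((Scheme.Modules.pullback f).mapHomologicalComplex (ComplexShape.up ℤ)).commShiftIso a).hom.app L)).f n ≫
            (((homFunctor X (((Scheme.Modules.pullback f).mapHomologicalComplex (ComplexShape.up ℤ)).obj K)).commShiftIso a).hom.app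
                (((Scheme.Modules.pullback f).mapHomologicalComplex (ComplexShape.up ℤ)).obj L)).f n =
      sheafHomPullbackComparison f (K.X (-q)) (L.X (p + a)) ≫
        ι X (((Scheme.Modules.pullback f).mapHomologicalComplex (ComplexShape.up ℤ)).obj K)
          (((Scheme.Modules.pullback f).mapHomologicalComplex (ComplexShape.up ℤ)).obj L) (p + a) q (n + a) (by omega) := by
  have h1 := map_ι_comp_homFunctorPullbackHomApp_f f K (L⟦a⟧) p q n hpq
  have h2 := ι_map X (((Scheme.Modules.pullback f).mapHomologicalComplex (ComplexShape.up ℤ)).obj K)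
    ((((Scheme.Modules.pullback f).mapHomologicalComplex (ComplexShape.up ℤ)).commShiftIso a).hom.app L) p q n hpq
  rw [Functor.mapHomologicalComplex_commShiftIso_hom_app_f, sheafHomMap_id] at h2
  erw [Category.id_comp] at h2
  rw [← Category.assoc, h1, Category.assoc, homFunctor_map_f, ← Category.assoc (ι X _ _ p q n hpq)]
  erw [h2]
  erw [Functor.commShiftIso_map₂CochainComplex_flip_hom_app]
  erw [CochainComplex.ι_mapBifunctorShift₁Iso_hom_f (((Scheme.Modules.pullback f).mapHomologicalComplex (ComplexShape.up ℤ)).obj L)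
    (dualComplex X (((Scheme.Modules.pullback f).mapHomologicalComplex (ComplexShape.up ℤ)).obj K)) (sheafHomBifunctor X).flip
    a p q n hpq (p + a) (n + a) rfl rfl]
  simp only [CochainComplex.shiftFunctorObjXIso, HomologicalComplex.XIsoOfEq, eqToIso_refl, Iso.refl_hom,
    Iso.refl_inv, Category.comp_id]
  rfl

/-- **`homFunctorPullbackHom` commutes with the shifts** (Mathlib `NatTrans.CommShift`), for the `BifunctorShift` structure on `𝓗om•(K, –)`
and `Functor.commShiftMapCochainComplex` on `f^*•` (all identities summand by summand). Stated as a theorem (a `Prop`); consumers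
`haveI` it. [cite: Weibel1994, §10.4 (reading: the comparison is one of triangulated functors)] -/
theorem homFunctorPullbackHom_commShift : NatTrans.CommShift (homFunctorPullbackHom f K) ℤ where
  shift_comm a := by
    ext L n : 3
    refine pullback_ι_hom_ext f K fun p q hpq => ?_
    simp only [NatTrans.comp_app, Functor.whiskerRight_app, Functor.whiskerLeft_app,
      Functor.commShiftIso_comp_hom_app, homFunctorPullbackHom_app, HomologicalComplex.comp_f,
      Functor.mapHomologicalComplex_map_f, Category.assoc]
    rw [pullback_shift_comm_summand_lhs, pullback_shift_comm_summand_rhs]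

end Summit.HodgeConjecture.HodgeConjecture.Ring2.SemiregularRepresentatives

end
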